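import Summits.CriticalPhenomena.CardyFormulaZ2.Theorems.CardyUSTContinuationKirchhoffExtremalLengthG02Dual2

/-!
# Exits of the face component near a boundary point have equal virtual values
# ([GP19] §3.1 for the `meshDomain` / `discreteArc` discretisation)

Support file for `KirchhoffExtremalLength` (route CardyUSTContinuation of `CardyFormulaZ2`, item
stmt-CriticalPhenomena-11234), towards the upper half of `G02ModulusConvergence` (`…Defs.lean`).
Transposition of §D5 of the tree's `SquareTilingConjugate.lean` to `Ω_δ = discreteDomainGraph Ω δ`:

* **walks of squares do not wind around far discrete boundary vertices**
  (`walkWinding_eq_zero_of_mem_meshBoundary'`, general form: the squares are inner faces or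
  near a boundary point `q`, the vertex is far from `q`);
* **exits joined near `q` by a flux-free walk have equal virtual values**
  (`faceExitVal_eq_faceExitVal`). Unlike the tree's `SquareTiling.exitVal_eq_exitVal`, the
  connecting walk is a hypothesis: for this discretisation the shadow of a boundary arc may
  cross mesh edges (closed segments in `Ω̄` through boundary points), so the flux-free
  connections are built from EXTERIOR paths in `…G02Dual5`.
-/

noncomputable section

namespace Summit.CriticalPhenomena.CardyFormulaZ2.Theorems

namespace KirchhoffSlope

open Set Metric Filter Topology SimpleGraph
open Literature.Probability Literature.Probability.LatticeModels Literature.Probability.Percolation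
open Literature.Probability.LatticeModels.SquareTiling (stepFlux walkFlux walkFlux_cons walkFlux_nil
  walkFlux_append walkFlux_reverse stepFlux_antisymm closedSq floorSq corners mem_corners_iff
  sup_mem_corners walkWinding_eq_of_cornerChain mem_closedSq_floorSq abs_sub_floorSq_le_of_mem_closedSq
  exists_kingChain_of_path segment_subset_closedSq_inf mem_corners_inf meshPoint_mem_closedSq
  dist_le_of_mem_closedSq walkFlux_eq_zero_of_winding)
open Literature.Probability.RandomPlanarGeometry

variable {Ω : Set ℂ} {δ : ℝ}

open WeakBeurling in
/-- **Walks of squares do not wind around far boundary vertices** (general form of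
`walkWinding_eq_zero_of_mem_meshBoundary`): a closed walk of squares each of which is inner or
contains a point within `ρ - 4δ` of the boundary point `q` does not wind around a vertex `x` of
`∂Ω_n` at distance `≥ ε + 3δ` from `q`, where `ρ ≤ ε` is a radius such that exterior points at
distance `≥ ε` from `q` are joined in the exterior off `B̄(q, ρ)`
(`JordanDomain.exists_joinedIn_exterior_diff_closedBall`). [folklore] -/
theorem walkWinding_eq_zero_of_mem_meshBoundary' (R : ConformalRectangle) (hδ : 0 < δ) {a : Site 2}
    (Λ : (zdGraph 2).Walk a a) {s₀ ε ρ : ℝ}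
    (hε : 0 < ε) (hρε : ρ ≤ ε)
    (hρ : ∀ e y : ℂ, e ∈ (closure R.carrier)ᶜ → y ∈ (closure R.carrier)ᶜ →
      ε ≤ dist e (R.boundary s₀) → ε ≤ dist y (R.boundary s₀) →
      JoinedIn ((closure R.carrier)ᶜ \ closedBall (R.boundary s₀) ρ) e y)
    (hsupp : ∀ Q ∈ Λ.support, IsInnerFace R.carrier δ Q ∨ ∃ w ∈ closedSq δ Q, dist w (R.boundary s₀) < ρ - 4 * δ)
    {x : Site 2} (hx : x ∈ meshBoundary R.carrier δ) (hxq : ε + 3 * δ ≤ dist (meshPoint δ x) (R.boundary s₀)) :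
    walkWinding Λ (x - 1) = 0 := by
  set q := R.boundary s₀ with hq
  -- a square containing a point at distance `≥ ρ - 2δ` from `q` is not "near"
  have notnear : ∀ {Q : Site 2} {z : ℂ}, z ∈ closedSq δ Q → ρ - 2 * δ ≤ dist z q →
      ¬ ∃ w ∈ closedSq δ Q, dist w q < ρ - 4 * δ := by
    rintro Q z hz hzq ⟨w, hw, hwq⟩
    have := dist_le_of_mem_closedSq hz hw
    linarith [dist_triangle z w q]
  -- the missing edge at `x`, the frontier point `j` on it and the non-inner square `Q₁ = x ⊓ y`
  obtain ⟨hxD, y, hxy, hnadj⟩ := hx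
  obtain ⟨j, hjseg, hjf⟩ := exists_mem_frontier_of_not_discreteDomainGraph_adj R.toJordanDomain hxD hxy hnadj
  have hQ₁ : ¬ IsInnerFace R.carrier δ (x ⊓ y) := not_isInnerFace_inf hxy hnadj
  have hjQ₁ : j ∈ closedSq δ (x ⊓ y) := segment_subset_closedSq_inf hδ.le hxy hjseg
  have hxQ₁ : meshPoint δ x ∈ closedSq δ (x ⊓ y) := by
    refine meshPoint_mem_closedSq hδ.le ?_ ?_ <;>
      rcases stepKind_of_adj hxy with ⟨e0, e1⟩ | ⟨e0, e1⟩ | ⟨e1, e0⟩ | ⟨e1, e0⟩ <;>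
      simp only [Pi.inf_apply] <;> omega
  have hjx : dist (meshPoint δ x) j ≤ 2 * δ := dist_le_of_mem_closedSq hxQ₁ hjQ₁
  -- an exterior point near `j` and its square `Q'`
  obtain ⟨e', he', hje'⟩ := Metric.mem_closure_iff.1 (R.frontier_subset_closure_exterior' hjf) (δ / 2)
    (by positivity)
  have hQ' : ∃ c, c ∈ corners (x ⊓ y) ∧ c ∈ corners (floorSq δ e') :=
    ⟨_, sup_mem_corners (abs_sub_floorSq_le_of_mem_closedSq hδ hjQ₁ hje' 0)
      (abs_sub_floorSq_le_of_mem_closedSq hδ hjQ₁ hje' 1)⟩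
  have he'q : ε + δ / 2 ≤ dist e' q := by
    have h1 := dist_triangle (meshPoint δ x) j q
    have h2 := dist_triangle j e' q
    have h3 : dist j e' < δ / 2 := hje'
    linarith
  -- a far exterior point and an exterior path to it avoiding the ball
  obtain ⟨r₀, hr₀⟩ := (isBounded_iff_subset_closedBall (0 : ℂ)).1 R.isBounded
  have hr₀nn : 0 ≤ r₀ := (norm_nonneg _).trans (by simpa using hr₀ (meshDomain_subset_meshVertices _ _ hxD))
  have hqr : ‖q‖ ≤ r₀ := by
    have : q ∈ closedBall (0 : ℂ) r₀ :=
      closure_minimal hr₀ isClosed_closedBall (frontier_subset_closure (R.boundary_mem_frontier s₀))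
    simpa using this
  have hεpos : 0 ≤ ε := hε.le
  set N : ℤ := ⌈r₀ / δ⌉ with hN
  have hNnn : 0 ≤ (N : ℝ) := (div_nonneg hr₀nn hδ.le).trans (Int.le_ceil _)
  set X : ℝ := 2 * r₀ + 1 + ε + δ * (N + 4) with hX
  have hX0 : 0 < X := by rw [hX]; nlinarith
  have hXr : r₀ < X := by rw [hX]; nlinarith
  have hfar : (X : ℂ) ∈ (closure R.carrier)ᶜ := by
    intro hmem
    have : (X : ℂ) ∈ closedBall (0 : ℂ) r₀ := closure_minimal hr₀ isClosed_closedBall hmem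
    have h1 : ‖(X : ℂ)‖ ≤ r₀ := by simpa using this
    rw [Complex.norm_real, Real.norm_eq_abs, abs_of_pos hX0] at h1
    linarith
  have hXq : ε ≤ dist (X : ℂ) q := by
    have h1 : ‖(X : ℂ)‖ - ‖q‖ ≤ dist (X : ℂ) q := by
      rw [dist_eq_norm]; exact norm_sub_norm_le _ _
    rw [Complex.norm_real, Real.norm_eq_abs, abs_of_pos hX0] at h1
    nlinarith
  have hpath : JoinedIn ((closure R.carrier)ᶜ \ closedBall q ρ) e' (X : ℂ) :=
    hρ e' X he' hfar (by linarith) hXq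
  have hγc : ContinuousOn (fun t : ℝ => hpath.somePath.extend t) (Icc 0 1) :=
    hpath.somePath.continuous_extend.continuousOn
  have hγE : ∀ t ∈ Icc (0 : ℝ) 1, hpath.somePath.extend t ∈ (closure R.carrier)ᶜ \ closedBall q ρ := fun t ht => by
    rw [Path.extend_extends' hpath.somePath ⟨t, ht⟩]
    exact hpath.somePath_mem _
  obtain ⟨l, hchain, hmeet, hlast⟩ := exists_kingChain_of_path hδ hγc
  simp only [Path.extend_zero, Path.extend_one] at hchain hmeet hlast
  -- none of the squares of the chain `Q₁ :: Q' :: l` is visited by `Λ`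
  have hnot : ∀ Q ∈ (x ⊓ y) :: floorSq δ e' :: l, Q ∉ Λ.support := by
    intro Q hQ hQs
    rcases hsupp Q hQs with hQI | hQnear
    · rw [List.mem_cons] at hQ
      rcases hQ with rfl | hQ
      · exact hQ₁ hQI
      · obtain ⟨t, ht, hγt⟩ := hmeet Q hQ
        exact not_isInnerFace_of_mem_closedSq R hδ hγt (hγE t ht).1 hQI
    · rw [List.mem_cons] at hQ
      rcases hQ with rfl | hQ
      · exact notnear hxQ₁ (by linarith) hQnear
      · rw [List.mem_cons] at hQ
        rcases hQ with rfl | hQ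
        · refine notnear (mem_closedSq_floorSq hδ e') (by linarith) hQnear
        · obtain ⟨t, ht, hγt⟩ := hmeet Q (List.mem_cons_of_mem _ hQ)
          have hout := (hγE t ht).2
          rw [mem_closedBall, not_le] at hout
          exact notnear hγt (by linarith) hQnear
  have hchain' : List.IsChain (fun Q Q' => ∃ c, c ∈ corners Q ∧ c ∈ corners Q')
      ((x ⊓ y) :: floorSq δ e' :: l) :=
    List.isChain_cons_cons.2 ⟨hQ', hchain⟩
  have hW := walkWinding_eq_of_cornerChain Λ (floorSq δ e' :: l) (x ⊓ y) hnot hchain' x (mem_corners_inf x hxy)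
    (((x ⊓ y) :: floorSq δ e' :: l).getLast (by simp)) (by rw [corners]; simp)
  rw [hW]
  have hqN' : ((x ⊓ y) :: floorSq δ e' :: l).getLast (by simp) = (floorSq δ e' :: l).getLast (by simp) := by
    simp [List.getLast_cons]
  have hXQ : (X : ℂ) ∈ closedSq δ (((x ⊓ y) :: floorSq δ e' :: l).getLast (by simp)) := by
    rw [hqN']; exact hlast
  -- bounding box of `Λ`: inner squares in `sqBox 0 N`, near squares in the box `N + 1`… all in
  -- `sqBox 0 (2N + stuff)`; we use the box of the whole disc `B̄(0, 2 r₀ + ε + 1)`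
  refine walkWinding_eq_zero_of_not_mem_sqBox (p₀ := 0) (n := ⌈(2 * r₀ + 1 + ε) / δ⌉ + 1) (fun z hz => ?_) ?_
  · -- every visited square has a point of norm `≤ 2 r₀ + ε`, hence index in the box
    have hpt : ∃ w ∈ closedSq δ z, ‖w‖ ≤ 2 * r₀ + ε := by
      rcases hsupp z hz with hzI | ⟨w, hw, hwq⟩
      · have hzΩ : meshPoint δ z ∈ R.carrier := meshPoint_mem_of_isInnerFace hzI
        refine ⟨meshPoint δ z, meshPoint_mem_closedSq hδ.le (Or.inl rfl) (Or.inl rfl), ?_⟩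
        have : ‖meshPoint δ z‖ ≤ r₀ := by simpa using hr₀ hzΩ
        linarith
      · refine ⟨w, hw, ?_⟩
        have : ‖w‖ ≤ ‖q‖ + dist w q := by
          rw [dist_eq_norm]; linarith [norm_le_norm_add_norm_sub' w q, norm_sub_rev w q]
        have hρr : ρ ≤ r₀ + ε + 4 * δ := by linarith
        nlinarith [dist_nonneg (x := w) (y := q)]
    obtain ⟨w, ⟨hw0, hw0', hw1, hw1'⟩, hwn⟩ := hpt
    have hre := (Complex.abs_re_le_norm w).trans hwn
    have him := (Complex.abs_im_le_norm w).trans hwn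
    rw [abs_le] at hre him
    have hc : (2 * r₀ + 1 + ε) / δ ≤ ⌈(2 * r₀ + 1 + ε) / δ⌉ := Int.le_ceil _
    rw [div_le_iff₀ hδ] at hc
    rw [mem_sqBox]
    simp only [Pi.zero_apply, sub_zero]
    constructor
    · rw [abs_le]
      constructor
      · have h1 : δ * (-(⌈(2 * r₀ + 1 + ε) / δ⌉ + 1) : ℝ) < δ * z 0 := by nlinarith
        have h2 := lt_of_mul_lt_mul_left h1 hδ.le
        have h3 : (-(⌈(2 * r₀ + 1 + ε) / δ⌉ + 1) : ℤ) < z 0 := by exact_mod_cast h2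
        omega
      · have h1 : δ * (z 0 : ℝ) < δ * (⌈(2 * r₀ + 1 + ε) / δ⌉ + 1) := by nlinarith
        have h2 := lt_of_mul_lt_mul_left h1 hδ.le
        have h3 : z 0 < ⌈(2 * r₀ + 1 + ε) / δ⌉ + 1 := by exact_mod_cast h2
        omega
    · rw [abs_le]
      constructor
      · have h1 : δ * (-(⌈(2 * r₀ + 1 + ε) / δ⌉ + 1) : ℝ) < δ * z 1 := by nlinarith
        have h2 := lt_of_mul_lt_mul_left h1 hδ.le
        have h3 : (-(⌈(2 * r₀ + 1 + ε) / δ⌉ + 1) : ℤ) < z 1 := by exact_mod_cast h2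
        omega
      · have h1 : δ * (z 1 : ℝ) < δ * (⌈(2 * r₀ + 1 + ε) / δ⌉ + 1) := by nlinarith
        have h2 := lt_of_mul_lt_mul_left h1 hδ.le
        have h3 : z 1 < ⌈(2 * r₀ + 1 + ε) / δ⌉ + 1 := by exact_mod_cast h2
        omega
  · obtain ⟨-, hq0, -, -⟩ := hXQ
    simp only [Complex.ofReal_re] at hq0
    rw [mem_sqBox, not_and_or]
    left
    simp only [Pi.sub_apply, Pi.one_apply, Pi.zero_apply, sub_zero, not_le]
    have hc : (⌈(2 * r₀ + 1 + ε) / δ⌉ : ℝ) < (2 * r₀ + 1 + ε) / δ + 1 := Int.ceil_lt_add_one _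
    rw [div_add_one hδ.ne', lt_div_iff₀ hδ] at hc
    have h1 : δ * (⌈(2 * r₀ + 1 + ε) / δ⌉ + 3) < δ * (((((x ⊓ y) :: floorSq δ e' :: l).getLast (by simp)) 0 : ℝ) + 1) := by
      rw [hX] at hq0; nlinarith
    have h2 := lt_of_mul_lt_mul_left h1 hδ.le
    have h3 : ⌈(2 * r₀ + 1 + ε) / δ⌉ + 3 < (((x ⊓ y) :: floorSq δ e' :: l).getLast (by simp)) 0 + 1 := by
      exact_mod_cast h2
    rw [lt_abs]
    left
    omega

section ExitEquality

open WeakBeurling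

/-- Squares on a walk of the dual graph from an inner square are inner. [folklore] -/
theorem isInnerFace_of_mem_support' {p₀ p q : Site 2} (hp₀ : IsInnerFace Ω δ p₀)
    (W : (faceGraph Ω δ).Walk p₀ p) (hq : q ∈ W.support) : IsInnerFace Ω δ q := by
  by_cases hlen : W.length = 0
  · have hs : W.support = [p₀] := by
      have hnil : W.Nil := Walk.length_eq_zero_iff.mp hlen
      exact Walk.nil_iff_support_eq.mp hnil
    rw [hs, List.mem_singleton] at hq
    subst hq; exact hp₀
  · exact isInnerFace_of_mem_support W (Or.inr (Nat.pos_of_ne_zero hlen)) hq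


open Classical in
/-- **Exits near a boundary point away from `T ∪ B` have equal virtual values.** Let `h` be
harmonic for `Ω_δ` off `T ∪ B ⊆ ∂Ω_δ` and `facePot` its conjugate based at the inner face `p₀`.
Let `q` be a boundary point, `ρ ≤ ε` radii as in `JordanDomain.exists_joinedIn_exterior_diff_closedBall`,
and suppose all vertices of `T ∪ B` are at distance `≥ ε + 3δ` from `q`. Then two exits
`(p, p')`, `(p̃, p̃')` of the component of `p₀` whose outer squares are joined by a flux-free
walk of squares staying within `ρ - 4δ` of `q` (for this discretisation: a walk crossing only
NON-edges, e.g. the shadow of an exterior path, `…G02Dual5`) have the same virtual value: the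
loop "out through one exit, along the walk, back in through the other, home through the
component" has flux `E(p̃,p̃') - E(p,p')`, and winds around no vertex of `T ∪ B`
(cf. `SquareTiling.exitVal_eq_exitVal`, where the walk shadows a boundary arc). [folklore] -/
theorem faceExitVal_eq_faceExitVal (R : ConformalRectangle) (hδ : 0 < δ) {h : Site 2 → ℝ} {T B : Set (Site 2)}
    (hT : T ⊆ meshBoundary R.carrier δ) (hB : B ⊆ meshBoundary R.carrier δ)
    (hharm : ∀ x, x ∉ T → x ∉ B →
      ∑ y ∈ ((zdGraph 2).neighborFinset x).filter (fun y => (discreteDomainGraph R.carrier δ).Adj x y), (h y - h x) = 0)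
    {p₀ : Site 2} (hp₀ : IsInnerFace R.carrier δ p₀) {s₀ ε ρ : ℝ} (hε : 0 < ε) (hρε : ρ ≤ ε)
    (hρ : ∀ e y : ℂ, e ∈ (closure R.carrier)ᶜ → y ∈ (closure R.carrier)ᶜ →
      ε ≤ dist e (R.boundary s₀) → ε ≤ dist y (R.boundary s₀) →
      JoinedIn ((closure R.carrier)ᶜ \ closedBall (R.boundary s₀) ρ) e y)
    (hfar : ∀ x ∈ T ∪ B, ε + 3 * δ ≤ dist (meshPoint δ x) (R.boundary s₀))
    {p p' q₁ q₁' : Site 2} (hp : (faceGraph R.carrier δ).Reachable p₀ p) (hpp' : (zdGraph 2).Adj p p')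
    (hq₁ : (faceGraph R.carrier δ).Reachable p₀ q₁) (hqq' : (zdGraph 2).Adj q₁ q₁')
    (ω : (zdGraph 2).Walk p' q₁') (hωflux : walkFlux (ecurH R.carrier δ h) (ecurV R.carrier δ h) ω = 0)
    (hωs : ∀ Q ∈ ω.support, ∃ w ∈ closedSq δ Q, dist w (R.boundary s₀) < ρ - 4 * δ) :
    faceExitVal R.carrier δ h p₀ p p' = faceExitVal R.carrier δ h p₀ q₁ q₁' := by
  -- the walk through the component, from `p` to `q₁`
  obtain ⟨Wp⟩ := hp
  obtain ⟨Wq⟩ := hq₁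
  have hπflux : walkFlux (ecurH R.carrier δ h) (ecurV R.carrier δ h)
      ((Wp.reverse.append Wq).map (Hom.ofLE faceGraph_le_zdGraph')) =
      facePot R.carrier δ h p₀ q₁ - facePot R.carrier δ h p₀ p := by
    rw [facePot_eq_walkFlux R hδ hT hB hharm hp₀ Wp, facePot_eq_walkFlux R hδ hT hB hharm hp₀ Wq,
      Walk.map_append, walkFlux_append, ← Walk.reverse_map, walkFlux_reverse]
    ring
  -- the loop
  let Λ : (zdGraph 2).Walk p p := ((Wp.reverse.append Wq).map (Hom.ofLE faceGraph_le_zdGraph')).append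
    (Walk.cons hqq' (ω.reverse.append (Walk.cons hpp'.symm Walk.nil)))
  have hΛflux : walkFlux (ecurH R.carrier δ h) (ecurV R.carrier δ h) Λ =
      faceExitVal R.carrier δ h p₀ q₁ q₁' - faceExitVal R.carrier δ h p₀ p p' := by
    show walkFlux (ecurH R.carrier δ h) (ecurV R.carrier δ h) (((Wp.reverse.append Wq).map (Hom.ofLE faceGraph_le_zdGraph')).append
      (Walk.cons hqq' (ω.reverse.append (Walk.cons hpp'.symm Walk.nil)))) = _
    rw [walkFlux_append, walkFlux_cons, walkFlux_append, walkFlux_reverse, walkFlux_cons, walkFlux_nil,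
      hπflux, hωflux, stepFlux_antisymm _ _ (stepKind_of_adj hpp'), faceExitVal, faceExitVal]
    simp only [Hom.coe_ofLE, id_eq]
    ring
  -- its squares are inner or near `q`
  have hsupp : ∀ Q ∈ Λ.support, IsInnerFace R.carrier δ Q ∨ ∃ w ∈ closedSq δ Q, dist w (R.boundary s₀) < ρ - 4 * δ := by
    intro Q hQ
    have hQ' : Q ∈ ((Wp.reverse.append Wq).map (Hom.ofLE faceGraph_le_zdGraph')).support ∨
        Q ∈ (Walk.cons hqq' (ω.reverse.append (Walk.cons hpp'.symm Walk.nil))).support :=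
      (Walk.mem_support_append_iff _ _).1 hQ
    have near_of_ω : Q ∈ ω.support → IsInnerFace R.carrier δ Q ∨ ∃ w ∈ closedSq δ Q, dist w (R.boundary s₀) < ρ - 4 * δ :=
      fun hQω => Or.inr (hωs Q hQω)
    rcases hQ' with hQπ | hQr
    · left
      rw [Walk.support_map, List.mem_map] at hQπ
      obtain ⟨Q', hQ', rfl⟩ := hQπ
      rw [Walk.mem_support_append_iff, Walk.support_reverse, List.mem_reverse] at hQ'
      rcases hQ' with hQ' | hQ'
      · exact isInnerFace_of_mem_support' hp₀ Wp hQ'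
      · exact isInnerFace_of_mem_support' hp₀ Wq hQ'
    · rw [Walk.support_cons, List.mem_cons, Walk.mem_support_append_iff, Walk.support_reverse, List.mem_reverse,
        Walk.support_cons, Walk.support_nil] at hQr
      rcases hQr with h1 | hQω | hQ2
      · left; rw [h1]; exact isInnerFace_of_mem_support' hp₀ Wq (Walk.end_mem_support _)
      · exact near_of_ω hQω
      · simp only [List.mem_cons, List.not_mem_nil, or_false] at hQ2
        rcases hQ2 with h2 | h2
        · exact near_of_ω (h2 ▸ Walk.start_mem_support ω)
        · left; rw [h2]; exact isInnerFace_of_mem_support' hp₀ Wp (Walk.end_mem_support _)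
  -- zero flux by the divergence theorem
  obtain ⟨r₀, hr₀⟩ := (isBounded_iff_subset_closedBall (0 : ℂ)).1 R.isBounded
  set S : Finset (Site 2) := (sqBox_finite 0 (⌈r₀ / δ⌉ + 1)).toFinset with hS
  have hmemS : ∀ u, u ∉ S → u ∉ sqBox 0 (⌈r₀ / δ⌉ + 1) := fun u hu h => hu (by simpa [hS] using h)
  have hzero : walkFlux (ecurH R.carrier δ h) (ecurV R.carrier δ h) Λ = 0 := by
    refine walkFlux_eq_zero_of_winding (S := S)
      (fun u hu => (ecur_eq_zero_of_not_mem_sqBox hr₀ hδ h (hmemS u hu)).1)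
      (fun u hu => (ecur_eq_zero_of_not_mem_sqBox hr₀ hδ h (hmemS u hu)).2) _ fun u _ hdiv => ?_
    have hTB : u + 1 ∈ T ∨ u + 1 ∈ B := by
      by_contra hc
      rw [not_or] at hc
      exact hdiv (divAt_ecur_eq_zero hharm hc.1 hc.2)
    have hbd : u + 1 ∈ meshBoundary R.carrier δ := hTB.elim (fun h => hT h) (fun h => hB h)
    have := walkWinding_eq_zero_of_mem_meshBoundary' R hδ Λ hε hρε hρ hsupp hbd (hfar _ hTB)
    rwa [show u + 1 - 1 = u by abel] at this
  linarith


end ExitEquality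

end KirchhoffSlope

end Summit.CriticalPhenomena.CardyFormulaZ2.Theorems
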